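import Mathlib
import HarnessLib
import Literature.Probability.MarkovChains.BottleneckRatioSpectralGap
import Literature.Probability.MarkovChains.SpectralGapTestFunction

/-!
# The lower bound `Φ⋆²/2 ≤ Gap_R` of the Jerrum–Sinclair / Lawler–Sokal (Cheeger) inequality (Levin–Peres–Wilmer Theorem 13.10, lower bound; Lemma 13.13)

HONEST FRAMING: exact (Metropolis-corrected) sampling algorithms for lattice gauge theory; figures
of merit are autocorrelation/cost numbers at stated couplings and volumes; no continuum-physics claim.

Conventions of `TotalVariation.lean` / `BottleneckRatio.lean` / `PeskunOrdering.lean` /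
`DistinguishingStatistic.lean` / `BottleneckRatioSpectralGap.lean`: finite state space `X`, ROW kernel
`P : X → X → ℝ`, probability vector `π`, `edgeMeasure π P A B = Q(A,B) = Σ_{x∈A,y∈B} π(x)P(x,y)`,
`bottleneckRatio π P S = Φ(S) = Q(S,Sᶜ)/π(S)`, `bottleneckRatioStar π P = Φ⋆ = min{Φ(S) : 0 < π(S) ≤ ½}`,
`piInner π g h = ⟨g,h⟩_π`, `dirichletForm π P f = 𝓔(f) = ½ Σ_{x,y} π(x)P(x,y)[f(x) − f(y)]²` (Lemma 13.6),
`lawMean` / `lawVariance` = `E_π` / `Var_π`, and the RIGHT SPECTRAL GAP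
`spectralGapR π P = Gap_R = inf{𝓔(f) : f ⊥_π 1, ‖f‖_π = 1}` — the variational quantity that
Lemma 13.7 identifies with `γ = 1 − λ₂` for a reversible `P`.  Source: D. A. Levin, Y. Peres (with
E. L. Wilmer), *Markov Chains and Mixing Times*, 2nd ed., AMS 2017 [LevinPeres2017], §13.2.3
"Proof of the lower bound in Theorem 13.10".  Everything is PROVED (finite sums; 0 named facts).

* **Lemma 13.13** `LevinPeres2017_lemma_13_13` — for `ψ ≥ 0` with `π{ψ > 0} ≤ ½`:
  `Φ⋆ · E_π(ψ) ≤ Σ_{x,y : ψ(x) > ψ(y)} [ψ(x) − ψ(y)] Q(x,y)`, written order-free as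
  `Σ_{x,y} π(x)P(x,y)·max(ψ(x) − ψ(y), 0)` (the book orders `X` so that `ψ` is non-increasing and
  sums over `x < y`; ties contribute `0` either way) [cite: LevinPeres2017, §13.2.3 Lemma 13.13].
  PROOF = the printed one with the integral `∫₀^∞ π{ψ > t} dt` evaluated as the finite sum over the
  level sets of `ψ`: an induction on the number of points where `ψ > 0`, peeling off the lowest
  positive level `m` (`ψ = ψ' + m·1_S`, `S = {ψ > 0}`, and `max(ψ(x)−ψ(y),0) = max(ψ'(x)−ψ'(y),0) +
  m·1{x ∈ S, y ∉ S}`), each level set `S = {ψ > t}` contributing `Φ⋆ π(S) ≤ Q(S,Sᶜ)` exactly as in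
  the book ("Recalling that `Φ⋆` is defined as a minimum in (7.7), `Φ⋆ ≤ Q(S,Sᶜ)/π(S)`").  Also the
  mirrored form with `Q(Sᶜ,S) = Q(S,Sᶜ)` (Exercise 7.2, `edgeMeasure_compl_comm`) and their average
  `LevinPeres2017_lemma_13_13_abs`: `Φ⋆ · E_π(ψ) ≤ ½ Σ_{x,y} π(x)P(x,y)|ψ(x) − ψ(y)|`.
* `sq_bottleneckRatioStar_mul_sq_piInner_le` — the Cauchy–Schwarz display of the printed proof,
  for `f ≥ 0` with `π{f > 0} ≤ ½`: `Φ⋆² ⟨f,f⟩²_π ≤ ⟨(I−P)f,f⟩_π [2⟨f,f⟩_π − ⟨(I−P)f,f⟩_π]`, i.e.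
  `⟨f,f⟩²_π ≤ Φ⋆⁻² 𝓔(f)[2⟨f,f⟩_π − 𝓔(f)]` ("Applying Lemma 13.13 with `ψ = f²` … By the Cauchy–Schwarz
  inequality … Using the identity (13.2) of Lemma 13.6 and `[f(x) + f(y)]² = 2f²(x) + 2f²(y) −
  [f(x) − f(y)]²`") [cite: LevinPeres2017, §13.2.3, proof of the lower bound in Thm 13.10];
  `sq_bottleneckRatioStar_le_rayleigh` — "`Φ⋆² ≤ R(2 − R)`" with `R = 𝓔(f)/⟨f,f⟩_π`; and the
  consequence `sq_bottleneckRatioStar_mul_piInner_le`: `Φ⋆² ⟨f,f⟩_π ≤ 2𝓔(f)`.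
* **THEOREM 13.10, LOWER BOUND** [cite: LevinPeres2017, §13.2.2 Thm 13.10 eq. (13.6), lower bound
  `Φ⋆²/2 ≤ γ`]: `LevinPeres2017_thm_13_10_lower_var` — **`(Φ⋆²/2)·Var_π(f) ≤ 𝓔(f)` for EVERY `f`**;
  `LevinPeres2017_thm_13_10_lower` — **`Φ⋆²/2 ≤ Gap_R(P)`**; and with the upper bound of
  `BottleneckRatioSpectralGap.lean`, `LevinPeres2017_thm_13_10_gapR`: `Φ⋆²/2 ≤ Gap_R ≤ 2Φ⋆`.
  HYPOTHESES: `P` row-stochastic, `πP = π`, `π ≥ 0`, `Σ π = 1` — reversibility is NOT used (the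
  symmetry the printed Cauchy–Schwarz step takes from reversibility is supplied by Exercise 7.2,
  `Q(S,Sᶜ) = Q(Sᶜ,S)`, which holds for every stationary `π`).
  DEVIATION (declared): the book reduces to a non-negative function supported on a set of mass `≤ ½`
  by taking `f = max{f₂, 0}` for an eigenfunction `f₂` of `λ₂` and proving `(I − P)f ≤ γf` (13.8),
  which needs the spectral theorem (Lemma 12.2) and gives the bound for `γ = 1 − λ₂` only.  Here the
  reduction is done for an ARBITRARY `f` by splitting at a `π`-MEDIAN `c` (`exists_median`:
  `π{f > c} ≤ ½`, `π{f < c} ≤ ½`): `𝓔(f) = 𝓔(f − c) ≥ 𝓔((f−c)⁺) + 𝓔((f−c)⁻)`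
  (`dirichletForm_posPart_add_negPart_le`), both parts satisfy the hypothesis of Lemma 13.13, and
  `⟨(f−c)⁺,(f−c)⁺⟩_π + ⟨(f−c)⁻,(f−c)⁻⟩_π = ⟨f−c,f−c⟩_π ≥ Var_π(f)`.  This is the shorter road to the
  tree's variational `Gap_R` (no eigenfunctions), in the manner of Lawler–Sokal's original proof,
  which bounds the Rayleigh quotient of an arbitrary `f ⊥ 1` after a constant shift `g = f + c`
  [cite: LawlerSokal1988, §2, proof of the lower bound in Thm 2.1, (2.19)–(2.25)]; the constant
  `½` of the book is kept.  For a reversible `P`, `Gap_R = γ = 1 − λ₂` is Lemma 13.7 (not in this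
  file), under which `LevinPeres2017_thm_13_10_lower` is the printed `Φ⋆²/2 ≤ γ`.

Context (cell pub-lqcd, venture LatticeQCDFlow): the conductance bound of Sinclair–Jerrum (1989) /
Lawler–Sokal (1988) is the printed counterpart "NAMED ONLY" in
`Summits/Ventures/LatticeQCDFlow/Scoring/SectorBottleneckFloor.lean`; `BottleneckRatioSpectralGap.lean`
typed its easy half `Gap_R ≤ 2Φ⋆`, this file the hard half.
-/

namespace Literature.Probability.MarkovChains

open Finset Matrix

variable {X : Type*} [Fintype X] [DecidableEq X]

/-! ## Lemma 13.13 (the co-area bound) -/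

omit [DecidableEq X] in
/-- `max(a,0) + max(−a,0) = |a|`. [folklore] -/
private theorem max_zero_add_max_neg_zero (a : ℝ) : max a 0 + max (-a) 0 = |a| := by
  rcases le_total 0 a with h | h
  · rw [max_eq_left h, max_eq_right (neg_nonpos.mpr h), abs_of_nonneg h, add_zero]
  · rw [max_eq_right h, max_eq_left (neg_nonneg.mpr h), abs_of_nonpos h, zero_add]

/-- The co-area induction behind Lemma 13.13: if a weight `w` dominates `K·π` on every
cut of a set of mass `≤ ½` (`K π(S) ≤ Σ_{x∈S,y∉S} w(x,y)`), then `K·E_π(ψ) ≤ Σ_{x,y} w(x,y)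
max(ψ(x) − ψ(y), 0)` for every `ψ ≥ 0` with `π{ψ > 0} ≤ ½` — "integrating over `t`" the level-set
inequalities, here as an induction on the number of points where `ψ > 0` (peel off the lowest
positive level). [cite: LevinPeres2017, §13.2.3 Lemma 13.13 (proof)] -/
private theorem coarea_induction {π : X → ℝ} (hπ0 : ∀ x, 0 ≤ π x) {w : X → X → ℝ} {K : ℝ}
    (hcut : ∀ S : Finset X, ∑ x ∈ S, π x ≤ 1 / 2 → K * ∑ x ∈ S, π x ≤ ∑ x ∈ S, ∑ y ∈ Sᶜ, w x y) :
    ∀ (n : ℕ) (ψ : X → ℝ), (∀ x, 0 ≤ ψ x) → (univ.filter (fun x => 0 < ψ x)).card ≤ n →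
      ∑ x ∈ univ.filter (fun x => 0 < ψ x), π x ≤ 1 / 2 →
      K * ∑ x, π x * ψ x ≤ ∑ x, ∑ y, w x y * max (ψ x - ψ y) 0 := by
  intro n
  induction n with
  | zero =>
    intro ψ hψ hcard _
    have hS : univ.filter (fun x => 0 < ψ x) = ∅ := card_eq_zero.mp (Nat.le_zero.mp hcard)
    have hψ0 : ∀ x, ψ x = 0 := by
      intro x
      have hx : x ∉ univ.filter (fun x => 0 < ψ x) := by rw [hS]; exact notMem_empty x
      have : ¬ 0 < ψ x := fun h => hx (mem_filter.mpr ⟨mem_univ x, h⟩)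
      exact le_antisymm (not_lt.mp this) (hψ x)
    simp [hψ0]
  | succ n ih =>
    intro ψ hψ hcard hhalf
    set S := univ.filter (fun x => 0 < ψ x) with hSdef
    have hψS : ∀ x, x ∉ S → ψ x = 0 := fun x hx => by
      have : ¬ 0 < ψ x := fun h => hx (mem_filter.mpr ⟨mem_univ x, h⟩)
      exact le_antisymm (not_lt.mp this) (hψ x)
    by_cases hSe : S = ∅
    · have hψ0 : ∀ x, ψ x = 0 := fun x => hψS x (by rw [hSe]; exact notMem_empty x)
      simp [hψ0]
    · -- the lowest positive level `m = ψ x₀`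
      obtain ⟨x₀, hx₀S, hmin⟩ := exists_min_image S ψ (nonempty_of_ne_empty hSe)
      set m := ψ x₀ with hm
      have hm0 : 0 < m := (mem_filter.mp hx₀S).2
      have hmS : ∀ x, x ∈ S → m ≤ ψ x := fun x hx => hmin x hx
      -- `ψ' = ψ − m` on `S`, `0` off `S`
      set ψ' : X → ℝ := fun x => if x ∈ S then ψ x - m else 0 with hψ'
      have hψ'S : ∀ x, x ∈ S → ψ' x = ψ x - m := fun x hx => by simp only [hψ', if_pos hx]
      have hψ'nS : ∀ x, x ∉ S → ψ' x = 0 := fun x hx => by simp only [hψ', if_neg hx]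
      have hψ'0 : ∀ x, 0 ≤ ψ' x := by
        intro x
        by_cases hx : x ∈ S
        · rw [hψ'S x hx]; exact sub_nonneg.mpr (hmS x hx)
        · rw [hψ'nS x hx]
      -- the support of `ψ'` lies in `S` minus `x₀`
      have hsupp' : univ.filter (fun x => 0 < ψ' x) ⊆ S.erase x₀ := by
        intro x hx
        have hx' : 0 < ψ' x := (mem_filter.mp hx).2
        have hxS : x ∈ S := by
          by_contra h
          rw [hψ'nS x h] at hx'
          exact lt_irrefl _ hx'
        refine mem_erase.mpr ⟨?_, hxS⟩
        rintro rfl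
        rw [hψ'S _ hxS, ← hm, sub_self] at hx'
        exact lt_irrefl _ hx'
      have hcard' : (univ.filter (fun x => 0 < ψ' x)).card ≤ n := by
        have h1 := card_le_card hsupp'
        rw [card_erase_of_mem hx₀S] at h1
        have h2 : S.card ≤ n + 1 := hcard
        omega
      have hhalf' : ∑ x ∈ univ.filter (fun x => 0 < ψ' x), π x ≤ 1 / 2 :=
        (sum_le_sum_of_subset_of_nonneg (hsupp'.trans (erase_subset _ _))
          (fun x _ _ => hπ0 x)).trans hhalf
      have IH := ih ψ' hψ'0 hcard' hhalf'
      -- the level set `S` itself: `K π(S) ≤ Σ_{x∈S, y∉S} w`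
      have hS_cut := hcut S hhalf
      -- decomposition of the left side: `E_π ψ = E_π ψ' + m π(S)`
      have hL : ∑ x, π x * ψ x = ∑ x, π x * ψ' x + m * ∑ x ∈ S, π x := by
        have h1 : ∀ x, π x * ψ x = π x * ψ' x + (if x ∈ S then m * π x else 0) := by
          intro x
          by_cases hx : x ∈ S
          · rw [hψ'S x hx, if_pos hx]; ring
          · rw [hψ'nS x hx, hψS x hx, if_neg hx]; ring
        rw [sum_congr rfl fun x _ => h1 x, sum_add_distrib, ← sum_filter, filter_mem_eq_inter,
          univ_inter, mul_sum]
      -- decomposition of the right side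
      have hR : ∀ x y, max (ψ x - ψ y) 0 =
          max (ψ' x - ψ' y) 0 + (if x ∈ S then (if y ∈ S then 0 else m) else 0) := by
        intro x y
        by_cases hx : x ∈ S
        · by_cases hy : y ∈ S
          · rw [if_pos hx, if_pos hy, hψ'S x hx, hψ'S y hy]; ring_nf
          · rw [if_pos hx, if_neg hy, hψ'S x hx, hψ'nS y hy, hψS y hy, sub_zero, sub_zero,
              max_eq_left (hψ x), max_eq_left (sub_nonneg.mpr (hmS x hx))]
            ring
        · by_cases hy : y ∈ S
          · rw [if_neg hx, hψ'nS x hx, hψS x hx, zero_sub, zero_sub, add_zero,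
              max_eq_right (neg_nonpos.mpr (hψ y)), max_eq_right (neg_nonpos.mpr (hψ'0 y))]
          · rw [if_neg hx, hψ'nS x hx, hψ'nS y hy, hψS x hx, hψS y hy, add_zero]
      have hRsum : ∑ x, ∑ y, w x y * max (ψ x - ψ y) 0 =
          ∑ x, ∑ y, w x y * max (ψ' x - ψ' y) 0 + m * ∑ x ∈ S, ∑ y ∈ Sᶜ, w x y := by
        have h1 : ∀ x, ∑ y, w x y * max (ψ x - ψ y) 0 =
            ∑ y, w x y * max (ψ' x - ψ' y) 0 +
              (if x ∈ S then m * ∑ y ∈ Sᶜ, w x y else 0) := by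
          intro x
          have h2 : ∀ y, w x y * max (ψ x - ψ y) 0 = w x y * max (ψ' x - ψ' y) 0 +
              w x y * (if x ∈ S then (if y ∈ S then 0 else m) else 0) := by
            intro y; rw [hR x y]; ring
          rw [sum_congr rfl fun y _ => h2 y, sum_add_distrib]
          congr 1
          by_cases hx : x ∈ S
          · simp_rw [if_pos hx]
            rw [← sum_add_sum_compl S (fun y => w x y * (if y ∈ S then (0:ℝ) else m))]
            have hA : ∑ y ∈ S, w x y * (if y ∈ S then (0:ℝ) else m) = 0 :=
              sum_eq_zero fun y hy => by rw [if_pos hy, mul_zero]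
            have hB : ∑ y ∈ Sᶜ, w x y * (if y ∈ S then (0:ℝ) else m) = ∑ y ∈ Sᶜ, w x y * m :=
              sum_congr rfl fun y hy => by rw [if_neg (mem_compl.mp hy)]
            rw [hA, hB, zero_add, mul_sum]
            exact sum_congr rfl fun y _ => by ring
          · simp_rw [if_neg hx, mul_zero, sum_const_zero]
        rw [sum_congr rfl fun x _ => h1 x, sum_add_distrib, ← sum_filter, filter_mem_eq_inter,
          univ_inter, mul_sum]
      -- assemble
      rw [hL, hRsum, mul_add]
      have hlevel : K * (m * ∑ x ∈ S, π x) ≤ m * ∑ x ∈ S, ∑ y ∈ Sᶜ, w x y := by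
        have := mul_le_mul_of_nonneg_left hS_cut hm0.le
        linarith [this]
      linarith [IH, hlevel]

omit [DecidableEq X] in
/-- The level-set inequality of the printed proof: `Φ⋆ π(S) ≤ Q(S,Sᶜ)` for every `S` with
`π(S) ≤ ½` (for `π ≥ 0`, `P ≥ 0`; when `π(S) = 0` both sides are handled by `Q ≥ 0`).
[cite: LevinPeres2017, §13.2.3 Lemma 13.13 (proof: "`Φ⋆ ≤ Q(S,Sᶜ)/π(S)`")] -/
theorem bottleneckRatioStar_mul_le_edgeMeasure [DecidableEq X] {P : X → X → ℝ}
    (hP0 : ∀ x y, 0 ≤ P x y) {π : X → ℝ} (hπ0 : ∀ x, 0 ≤ π x) {S : Finset X}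
    (hS : ∑ x ∈ S, π x ≤ 1 / 2) :
    bottleneckRatioStar π P * ∑ x ∈ S, π x ≤ edgeMeasure π P S Sᶜ := by
  rcases (sum_nonneg fun x (_ : x ∈ S) => hπ0 x).eq_or_lt with h0 | h0
  · rw [← h0, mul_zero]
    exact edgeMeasure_nonneg hπ0 hP0 S Sᶜ
  · have h := bottleneckRatioStar_le π P h0 hS
    unfold bottleneckRatio at h
    exact (le_div_iff₀ h0).mp h

/-- **Lemma 13.13.**  For a non-negative `ψ` on `X` with `π{ψ > 0} ≤ ½`,
`Φ⋆ · E_π(ψ) ≤ Σ_{x,y : ψ(x) > ψ(y)} [ψ(x) − ψ(y)] Q(x,y)` — the book's `Σ_{x<y}` after ordering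
`X` so that `ψ` is non-increasing, written order-free with `max(ψ(x) − ψ(y), 0)`; `Q(x,y) =
π(x)P(x,y)`.  For `π ≥ 0` and `P ≥ 0`. [cite: LevinPeres2017, §13.2.3 Lemma 13.13] -/
theorem LevinPeres2017_lemma_13_13 {P : X → X → ℝ} (hP0 : ∀ x y, 0 ≤ P x y) {π : X → ℝ}
    (hπ0 : ∀ x, 0 ≤ π x) {ψ : X → ℝ} (hψ : ∀ x, 0 ≤ ψ x)
    (hhalf : ∑ x ∈ univ.filter (fun x => 0 < ψ x), π x ≤ 1 / 2) :
    bottleneckRatioStar π P * ∑ x, π x * ψ x ≤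
      ∑ x, ∑ y, π x * P x y * max (ψ x - ψ y) 0 := by
  refine coarea_induction hπ0 (w := fun x y => π x * P x y) (fun S hS => ?_) _ ψ hψ le_rfl hhalf
  exact bottleneckRatioStar_mul_le_edgeMeasure hP0 hπ0 hS

/-- Lemma 13.13 with the cut read from the other side, `Φ⋆ π(S) ≤ Q(Sᶜ,S) = Q(S,Sᶜ)`
(Exercise 7.2): `Φ⋆ · E_π(ψ) ≤ Σ_{x,y} π(x)P(x,y) max(ψ(y) − ψ(x), 0)`, for a row-stochastic `P`
with `πP = π`. [cite: LevinPeres2017, §13.2.3 Lemma 13.13 with Exercise 7.2] -/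
theorem LevinPeres2017_lemma_13_13_rev {P : X → X → ℝ} (hP : IsRowStochastic P) {π : X → ℝ}
    (hπ : IsStationary π P) (hπ0 : ∀ x, 0 ≤ π x) {ψ : X → ℝ} (hψ : ∀ x, 0 ≤ ψ x)
    (hhalf : ∑ x ∈ univ.filter (fun x => 0 < ψ x), π x ≤ 1 / 2) :
    bottleneckRatioStar π P * ∑ x, π x * ψ x ≤
      ∑ x, ∑ y, π x * P x y * max (ψ y - ψ x) 0 := by
  have h := coarea_induction hπ0 (w := fun x y => π y * P y x) (K := bottleneckRatioStar π P)
    (fun S hS => ?_) _ ψ hψ le_rfl hhalf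
  · calc bottleneckRatioStar π P * ∑ x, π x * ψ x
        ≤ ∑ x, ∑ y, π y * P y x * max (ψ x - ψ y) 0 := h
      _ = ∑ x, ∑ y, π x * P x y * max (ψ y - ψ x) 0 := sum_comm
  · calc bottleneckRatioStar π P * ∑ x ∈ S, π x ≤ edgeMeasure π P S Sᶜ :=
          bottleneckRatioStar_mul_le_edgeMeasure hP.1 hπ0 hS
      _ = edgeMeasure π P Sᶜ S := edgeMeasure_compl_comm hP hπ S
      _ = ∑ x ∈ S, ∑ y ∈ Sᶜ, π y * P y x := by unfold edgeMeasure; exact sum_comm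

/-- The symmetrised Lemma 13.13: `Φ⋆ · E_π(ψ) ≤ ½ Σ_{x,y} π(x)P(x,y) |ψ(x) − ψ(y)|` for `ψ ≥ 0`
with `π{ψ > 0} ≤ ½`, a row-stochastic `P` and `πP = π` (average of the two one-sided forms).
[cite: LevinPeres2017, §13.2.3 Lemma 13.13 with Exercise 7.2] -/
theorem LevinPeres2017_lemma_13_13_abs {P : X → X → ℝ} (hP : IsRowStochastic P) {π : X → ℝ}
    (hπ : IsStationary π P) (hπ0 : ∀ x, 0 ≤ π x) {ψ : X → ℝ} (hψ : ∀ x, 0 ≤ ψ x)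
    (hhalf : ∑ x ∈ univ.filter (fun x => 0 < ψ x), π x ≤ 1 / 2) :
    bottleneckRatioStar π P * ∑ x, π x * ψ x ≤
      (1 / 2) * ∑ x, ∑ y, π x * P x y * |ψ x - ψ y| := by
  have h1 := LevinPeres2017_lemma_13_13 hP.1 hπ0 hψ hhalf
  have h2 := LevinPeres2017_lemma_13_13_rev hP hπ hπ0 hψ hhalf
  have hsum : ∑ x, ∑ y, π x * P x y * max (ψ x - ψ y) 0 +
      ∑ x, ∑ y, π x * P x y * max (ψ y - ψ x) 0 = ∑ x, ∑ y, π x * P x y * |ψ x - ψ y| := by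
    rw [← sum_add_distrib]
    refine sum_congr rfl fun x _ => ?_
    rw [← sum_add_distrib]
    refine sum_congr rfl fun y _ => ?_
    rw [← mul_add, ← max_zero_add_max_neg_zero (ψ x - ψ y), neg_sub]
  linarith

/-! ## The Cauchy–Schwarz step -/

omit [DecidableEq X] in
/-- `Σ_{x,y} π(x)P(x,y) f(x)² = ⟨f,f⟩_π` (unit row sums). [cite: LevinPeres2017, §13.2.1 Lemma 13.6
(proof: "`½ Σ_x f(x)²π(x) Σ_y P(x,y) = ½ Σ_x f(x)²π(x)`")] -/
private theorem sum_sum_mul_sq_left {P : X → X → ℝ} (hP : IsRowStochastic P) (π f : X → ℝ) :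
    ∑ x, ∑ y, π x * P x y * f x ^ 2 = piInner π f f := by
  unfold piInner
  refine sum_congr rfl fun x _ => ?_
  have : ∑ y, π x * P x y * f x ^ 2 = π x * f x ^ 2 * ∑ y, P x y := by
    rw [mul_sum]; exact sum_congr rfl fun y _ => by ring
  rw [this, hP.2 x, mul_one, sq]

omit [DecidableEq X] in
/-- `Σ_{x,y} π(x)P(x,y) f(y)² = ⟨f,f⟩_π` (stationarity). [cite: LevinPeres2017, §13.2.1 Lemma 13.6
(proof, the "last term")] -/
private theorem sum_sum_mul_sq_right {P : X → X → ℝ} {π : X → ℝ} (hπ : IsStationary π P)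
    (f : X → ℝ) : ∑ x, ∑ y, π x * P x y * f y ^ 2 = piInner π f f := by
  unfold piInner
  rw [sum_comm]
  refine sum_congr rfl fun y _ => ?_
  rw [← sum_mul, hπ y, sq]

/-- The Cauchy–Schwarz display of the proof of the lower bound: for `f ≥ 0` with `π{f > 0} ≤ ½`,
`Φ⋆² ⟨f,f⟩²_π ≤ ⟨(I−P)f,f⟩_π · [2⟨f,f⟩_π − ⟨(I−P)f,f⟩_π]`, i.e. `⟨f,f⟩²_π ≤ Φ⋆⁻² 𝓔(f)[2⟨f,f⟩_π −
𝓔(f)]` ("Applying Lemma 13.13 with `ψ = f²` … By the Cauchy–Schwarz inequality … Using the identity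
(13.2) of Lemma 13.6 and `[f(x) + f(y)]² = 2f²(x) + 2f²(y) − [f(x) − f(y)]²`").  For a
row-stochastic `P` with `πP = π`, `π ≥ 0` (reversibility replaced by Exercise 7.2).
[cite: LevinPeres2017, §13.2.3, proof of the lower bound in Thm 13.10] -/
theorem sq_bottleneckRatioStar_mul_sq_piInner_le {P : X → X → ℝ} (hP : IsRowStochastic P)
    {π : X → ℝ} (hπ : IsStationary π P) (hπ0 : ∀ x, 0 ≤ π x) {f : X → ℝ} (hf : ∀ x, 0 ≤ f x)
    (hhalf : ∑ x ∈ univ.filter (fun x => 0 < f x), π x ≤ 1 / 2) :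
    bottleneckRatioStar π P ^ 2 * piInner π f f ^ 2 ≤
      dirichletForm π P f * (2 * piInner π f f - dirichletForm π P f) := by
  -- Lemma 13.13 for `ψ = f²`
  have hψ : ∀ x, 0 ≤ f x ^ 2 := fun x => sq_nonneg _
  have hfilter : univ.filter (fun x => 0 < f x ^ 2) = univ.filter (fun x => 0 < f x) := by
    refine filter_congr fun x _ => ?_
    constructor
    · intro h
      rcases (hf x).eq_or_lt with h0 | h0
      · rw [← h0] at h; norm_num at h
      · exact h0
    · intro h; positivity
  have hhalf2 : ∑ x ∈ univ.filter (fun x => 0 < f x ^ 2), π x ≤ 1 / 2 := by rwa [hfilter]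
  have h13 := LevinPeres2017_lemma_13_13_abs hP hπ hπ0 hψ hhalf2
  have hE : ∑ x, π x * f x ^ 2 = piInner π f f := by
    unfold piInner; exact sum_congr rfl fun x _ => by rw [sq]
  rw [hE] at h13
  -- `|f(x)² − f(y)²| = |f(x) − f(y)|·(f(x) + f(y))`
  have habs : ∀ x y, |f x ^ 2 - f y ^ 2| = |f x - f y| * (f x + f y) := by
    intro x y
    rw [sq_sub_sq, abs_mul, abs_of_nonneg (add_nonneg (hf x) (hf y)), mul_comm]
  simp_rw [habs] at h13
  -- square the inequality
  have hA0 : 0 ≤ bottleneckRatioStar π P * piInner π f f :=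
    mul_nonneg (bottleneckRatioStar_nonneg hπ0 hP.1)
      (sum_nonneg fun x _ => mul_nonneg (hπ0 x) (mul_self_nonneg _))
  have hsq := pow_le_pow_left₀ hA0 h13 2
  -- Cauchy–Schwarz on the double sum, as a sum over `X × X`
  have hCS : (∑ x, ∑ y, π x * P x y * (|f x - f y| * (f x + f y))) ^ 2 ≤
      (∑ x, ∑ y, π x * P x y * (f x - f y) ^ 2) * ∑ x, ∑ y, π x * P x y * (f x + f y) ^ 2 := by
    rw [← Fintype.sum_prod_type' (fun x y => π x * P x y * (|f x - f y| * (f x + f y))),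
      ← Fintype.sum_prod_type' (fun x y => π x * P x y * (f x - f y) ^ 2),
      ← Fintype.sum_prod_type' (fun x y => π x * P x y * (f x + f y) ^ 2)]
    refine sum_sq_le_sum_mul_sum_of_sq_le_mul univ
      (fun p _ => mul_nonneg (mul_nonneg (hπ0 p.1) (hP.1 p.1 p.2)) (sq_nonneg _))
      (fun p _ => mul_nonneg (mul_nonneg (hπ0 p.1) (hP.1 p.1 p.2)) (sq_nonneg _))
      (fun p _ => le_of_eq ?_)
    simp only [mul_pow, sq_abs]
    ring
  -- the two factors
  have hF1 : ∑ x, ∑ y, π x * P x y * (f x - f y) ^ 2 = 2 * dirichletForm π P f := by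
    unfold dirichletForm; ring
  have hF2 : ∑ x, ∑ y, π x * P x y * (f x + f y) ^ 2 =
      4 * piInner π f f - 2 * dirichletForm π P f := by
    have h1 : ∀ x y, π x * P x y * (f x + f y) ^ 2 =
        2 * (π x * P x y * f x ^ 2) + 2 * (π x * P x y * f y ^ 2) -
          π x * P x y * (f x - f y) ^ 2 := fun x y => by ring
    simp_rw [h1, sum_sub_distrib, sum_add_distrib, ← mul_sum]
    rw [sum_sum_mul_sq_left hP, sum_sum_mul_sq_right hπ, hF1]
    ring
  rw [hF1, hF2] at hCS
  calc bottleneckRatioStar π P ^ 2 * piInner π f f ^ 2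
      = (bottleneckRatioStar π P * piInner π f f) ^ 2 := by ring
    _ ≤ ((1 / 2) * ∑ x, ∑ y, π x * P x y * (|f x - f y| * (f x + f y))) ^ 2 := hsq
    _ = (1 / 4) * (∑ x, ∑ y, π x * P x y * (|f x - f y| * (f x + f y))) ^ 2 := by ring
    _ ≤ (1 / 4) * ((2 * dirichletForm π P f) * (4 * piInner π f f - 2 * dirichletForm π P f)) :=
        mul_le_mul_of_nonneg_left hCS (by norm_num)
    _ = dirichletForm π P f * (2 * piInner π f f - dirichletForm π P f) := by ring

/-- "Let `R := ⟨(I−P)f,f⟩_π/⟨f,f⟩_π` … `Φ⋆² ≤ R(2 − R)`": for `f ≥ 0`, `f ≢ 0` in `ℓ²(π)`, with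
`π{f > 0} ≤ ½`. [cite: LevinPeres2017, §13.2.3, proof of the lower bound in Thm 13.10] -/
theorem sq_bottleneckRatioStar_le_rayleigh {P : X → X → ℝ} (hP : IsRowStochastic P)
    {π : X → ℝ} (hπ : IsStationary π P) (hπ0 : ∀ x, 0 ≤ π x) {f : X → ℝ} (hf : ∀ x, 0 ≤ f x)
    (hhalf : ∑ x ∈ univ.filter (fun x => 0 < f x), π x ≤ 1 / 2) (hf0 : 0 < piInner π f f) :
    bottleneckRatioStar π P ^ 2 ≤
      (dirichletForm π P f / piInner π f f) * (2 - dirichletForm π P f / piInner π f f) := by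
  have h := sq_bottleneckRatioStar_mul_sq_piInner_le hP hπ hπ0 hf hhalf
  have hne : piInner π f f ≠ 0 := hf0.ne'
  have key : (dirichletForm π P f / piInner π f f) * (2 - dirichletForm π P f / piInner π f f) =
      dirichletForm π P f * (2 * piInner π f f - dirichletForm π P f) / piInner π f f ^ 2 := by
    field_simp
  rw [key, le_div_iff₀ (pow_pos hf0 2)]
  exact h

/-- `Φ⋆² ⟨f,f⟩_π ≤ 2𝓔(f)` for `f ≥ 0` with `π{f > 0} ≤ ½` (from `Φ⋆² ≤ R(2 − R) ≤ 2R`), for a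
row-stochastic `P` with `πP = π`, `π ≥ 0`.
[cite: LevinPeres2017, §13.2.3, proof of the lower bound in Thm 13.10] -/
theorem sq_bottleneckRatioStar_mul_piInner_le {P : X → X → ℝ} (hP : IsRowStochastic P)
    {π : X → ℝ} (hπ : IsStationary π P) (hπ0 : ∀ x, 0 ≤ π x) {f : X → ℝ} (hf : ∀ x, 0 ≤ f x)
    (hhalf : ∑ x ∈ univ.filter (fun x => 0 < f x), π x ≤ 1 / 2) :
    bottleneckRatioStar π P ^ 2 * piInner π f f ≤ 2 * dirichletForm π P f := by
  have h := sq_bottleneckRatioStar_mul_sq_piInner_le hP hπ hπ0 hf hhalf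
  have hE0 : 0 ≤ dirichletForm π P f := dirichletForm_nonneg hπ0 hP.1 f
  have hI0 : 0 ≤ piInner π f f := sum_nonneg fun x _ => mul_nonneg (hπ0 x) (mul_self_nonneg _)
  rcases hI0.eq_or_lt with h0 | h0
  · rw [← h0, mul_zero]; linarith
  · have h2 : bottleneckRatioStar π P ^ 2 * piInner π f f * piInner π f f ≤
        2 * dirichletForm π P f * piInner π f f := by
      nlinarith [sq_nonneg (dirichletForm π P f)]
    exact le_of_mul_le_mul_right h2 h0

/-! ## A `π`-median and the positive / negative parts -/

omit [DecidableEq X] in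
/-- A `π`-MEDIAN of `f`: a level `c` with `π{f > c} ≤ ½` and `π{f < c} ≤ ½` (for a probability
vector `π` on a finite space; `c` = the least value `v` of `f` with `π{f ≤ v} ≥ ½`).  [folklore]
(the device replacing the book's `π{f₂ > 0} ≤ ½` "if not, use `−f₂` instead"; cf.
[cite: LawlerSokal1988, §2, proof of Thm 2.1 ("Let `c` be a real constant (to be determined later)
and define `g = f + c`")]) -/
theorem exists_median {π : X → ℝ} (hπ1 : ∑ x, π x = 1) (f : X → ℝ) :
    ∃ c : ℝ, ∑ x ∈ univ.filter (fun x => c < f x), π x ≤ 1 / 2 ∧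
      ∑ x ∈ univ.filter (fun x => f x < c), π x ≤ 1 / 2 := by
  classical
  have hne : (univ : Finset X).Nonempty := by
    by_contra h
    rw [not_nonempty_iff_eq_empty] at h
    rw [h, sum_empty] at hπ1
    exact zero_ne_one hπ1
  set V : Finset ℝ := univ.image f with hV
  have hVne : V.Nonempty := hne.image f
  set T : Finset ℝ := V.filter (fun v => 1 / 2 ≤ ∑ x ∈ univ.filter (fun x => f x ≤ v), π x)
    with hT
  -- the largest value of `f` qualifies
  have hTne : T.Nonempty := by
    refine ⟨V.max' hVne, mem_filter.mpr ⟨max'_mem _ _, ?_⟩⟩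
    have hall : univ.filter (fun x => f x ≤ V.max' hVne) = univ :=
      filter_true_of_mem fun x _ => le_max' _ _ (mem_image_of_mem f (mem_univ x))
    rw [hall, hπ1]; norm_num
  set c := T.min' hTne with hc
  have hcT : c ∈ T := min'_mem _ _
  have hc1 : 1 / 2 ≤ ∑ x ∈ univ.filter (fun x => f x ≤ c), π x := (mem_filter.mp hcT).2
  refine ⟨c, ?_, ?_⟩
  · -- `π{f > c} = 1 − π{f ≤ c} ≤ ½`
    have hsplit := sum_filter_add_sum_filter_not univ (fun x => f x ≤ c) π
    rw [hπ1] at hsplit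
    have heq : univ.filter (fun x => ¬ f x ≤ c) = univ.filter (fun x => c < f x) :=
      filter_congr fun x _ => not_le
    rw [heq] at hsplit
    linarith
  · -- `π{f < c} ≤ ½` by minimality of `c`
    by_contra hlt
    rw [not_le] at hlt
    have hWne : (V.filter (fun v => v < c)).Nonempty := by
      by_contra hW
      rw [not_nonempty_iff_eq_empty] at hW
      have hempty : univ.filter (fun x => f x < c) = ∅ := by
        refine filter_false_of_mem fun x _ hx => ?_
        have : f x ∈ V.filter (fun v => v < c) :=
          mem_filter.mpr ⟨mem_image_of_mem f (mem_univ x), hx⟩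
        rw [hW] at this
        exact notMem_empty _ this
      rw [hempty, sum_empty] at hlt
      norm_num at hlt
    set v' := (V.filter (fun v => v < c)).max' hWne with hv'
    have hv'c : v' < c := (mem_filter.mp (max'_mem _ hWne)).2
    have hv'V : v' ∈ V := (mem_filter.mp (max'_mem _ hWne)).1
    have hsets : univ.filter (fun x => f x < c) = univ.filter (fun x => f x ≤ v') := by
      refine filter_congr fun x _ => ⟨fun hx => ?_, fun hx => lt_of_le_of_lt hx hv'c⟩
      exact le_max' _ _ (mem_filter.mpr ⟨mem_image_of_mem f (mem_univ x), hx⟩)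
    rw [hsets] at hlt
    have hv'T : v' ∈ T := mem_filter.mpr ⟨hv'V, hlt.le⟩
    have := min'_le T v' hv'T
    rw [← hc] at this
    linarith

omit [DecidableEq X] in
/-- Splitting at `0` can only lower the energy: `𝓔(u⁺) + 𝓔(u⁻) ≤ 𝓔(u)` with `u⁺ = max(u,0)`,
`u⁻ = max(−u,0)` (pointwise `[u⁺(x) − u⁺(y)]² + [u⁻(x) − u⁻(y)]² ≤ [u(x) − u(y)]²`), for `π ≥ 0`,
`P ≥ 0`.  [folklore] (the step replacing the book's `f = max{f₂, 0}` + (13.8)) -/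
private theorem dirichletForm_posPart_add_negPart_le {π : X → ℝ} (hπ0 : ∀ x, 0 ≤ π x) {P : X → X → ℝ}
    (hP0 : ∀ x y, 0 ≤ P x y) (u : X → ℝ) :
    dirichletForm π P (fun x => max (u x) 0) + dirichletForm π P (fun x => max (-u x) 0) ≤
      dirichletForm π P u := by
  unfold dirichletForm
  rw [← mul_add, ← sum_add_distrib]
  refine mul_le_mul_of_nonneg_left (sum_le_sum fun x _ => ?_) (by norm_num)
  rw [← sum_add_distrib]
  refine sum_le_sum fun y _ => ?_
  rw [← mul_add]
  refine mul_le_mul_of_nonneg_left ?_ (mul_nonneg (hπ0 x) (hP0 x y))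
  show (max (u x) 0 - max (u y) 0) ^ 2 + (max (-u x) 0 - max (-u y) 0) ^ 2 ≤ (u x - u y) ^ 2
  rcases le_total 0 (u x) with hx | hx <;> rcases le_total 0 (u y) with hy | hy
  · rw [max_eq_left hx, max_eq_left hy, max_eq_right (neg_nonpos.mpr hx),
      max_eq_right (neg_nonpos.mpr hy)]
    nlinarith
  · rw [max_eq_left hx, max_eq_right hy, max_eq_right (neg_nonpos.mpr hx),
      max_eq_left (neg_nonneg.mpr hy)]
    nlinarith [mul_nonneg hx (neg_nonneg.mpr hy)]
  · rw [max_eq_right hx, max_eq_left hy, max_eq_left (neg_nonneg.mpr hx),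
      max_eq_right (neg_nonpos.mpr hy)]
    nlinarith [mul_nonneg (neg_nonneg.mpr hx) hy]
  · rw [max_eq_right hx, max_eq_right hy, max_eq_left (neg_nonneg.mpr hx),
      max_eq_left (neg_nonneg.mpr hy)]
    nlinarith

omit [DecidableEq X] in
/-- `⟨u⁺,u⁺⟩_π + ⟨u⁻,u⁻⟩_π = ⟨u,u⟩_π` (pointwise `u⁺ u⁻ = 0`). [folklore] -/
private theorem piInner_posPart_add_negPart (π u : X → ℝ) :
    piInner π (fun x => max (u x) 0) (fun x => max (u x) 0) +
      piInner π (fun x => max (-u x) 0) (fun x => max (-u x) 0) = piInner π u u := by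
  unfold piInner
  rw [← sum_add_distrib]
  refine sum_congr rfl fun x _ => ?_
  show π x * (max (u x) 0 * max (u x) 0) + π x * (max (-u x) 0 * max (-u x) 0) = π x * (u x * u x)
  rcases le_total 0 (u x) with hx | hx
  · rw [max_eq_left hx, max_eq_right (neg_nonpos.mpr hx)]; ring
  · rw [max_eq_right hx, max_eq_left (neg_nonneg.mpr hx)]; ring

omit [DecidableEq X] in
/-- `⟨f − c, f − c⟩_π = Var_π(f) + (E_π f − c)²` for a probability vector `π`: the variance is the
least quadratic deviation from a constant. [cite: LevinPeres2017, §13.2.1 Remark 13.8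
(`Var_π(f) = ‖f − E_π(f)‖²₂`)] -/
theorem piInner_sub_const_eq {π : X → ℝ} (hπ1 : ∑ x, π x = 1) (f : X → ℝ) (c : ℝ) :
    piInner π (fun x => f x - c) (fun x => f x - c) = lawVariance π f + (lawMean π f - c) ^ 2 := by
  have h0 := sum_mul_sub_lawMean hπ1 f
  unfold piInner lawVariance
  set m := lawMean π f with hm
  have h1 : ∀ x, π x * ((f x - c) * (f x - c)) =
      π x * (f x - m) ^ 2 + 2 * (m - c) * (π x * (f x - m)) + (m - c) ^ 2 * π x := by
    intro x; ring
  simp_rw [h1, sum_add_distrib, ← mul_sum, h0, hπ1]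
  ring

/-! ## Theorem 13.10, lower bound -/

/-- **Theorem 13.10, lower bound, as a Poincaré-type inequality: `(Φ⋆²/2)·Var_π(f) ≤ 𝓔(f)` for
EVERY `f`**, for a row-stochastic `P` with stationary probability vector `π ≥ 0`.  Proof: split `f`
at a `π`-median `c`; `𝓔(f) = 𝓔(f − c) ≥ 𝓔((f−c)⁺) + 𝓔((f−c)⁻) ≥ (Φ⋆²/2)(⟨(f−c)⁺,(f−c)⁺⟩_π +
⟨(f−c)⁻,(f−c)⁻⟩_π) = (Φ⋆²/2)⟨f−c,f−c⟩_π ≥ (Φ⋆²/2)Var_π(f)`, the middle step being Lemma 13.13 +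
Cauchy–Schwarz applied to each part (declared deviation from the printed eigenfunction reduction,
see the module docstring). [cite: LevinPeres2017, §13.2.2 Thm 13.10 eq. (13.6) (lower bound) with
§13.2.1 Remark 13.8 (`γ = min 𝓔(f)/Var_π(f)`)] -/
theorem LevinPeres2017_thm_13_10_lower_var {P : X → X → ℝ} (hP : IsRowStochastic P) {π : X → ℝ}
    (hπ : IsStationary π P) (hπ0 : ∀ x, 0 ≤ π x) (hπ1 : ∑ x, π x = 1) (f : X → ℝ) :
    bottleneckRatioStar π P ^ 2 / 2 * lawVariance π f ≤ dirichletForm π P f := by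
  obtain ⟨c, hc1, hc2⟩ := exists_median hπ1 f
  set u : X → ℝ := fun x => f x - c with hu
  -- the two parts satisfy the hypothesis of Lemma 13.13
  have hpos : ∑ x ∈ univ.filter (fun x => 0 < max (u x) 0), π x ≤ 1 / 2 := by
    have : univ.filter (fun x => 0 < max (u x) 0) = univ.filter (fun x => c < f x) := by
      refine filter_congr fun x _ => ?_
      rw [lt_max_iff, hu]
      simp only [lt_self_iff_false, or_false, sub_pos]
    rw [this]; exact hc1
  have hneg : ∑ x ∈ univ.filter (fun x => 0 < max (-u x) 0), π x ≤ 1 / 2 := by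
    have : univ.filter (fun x => 0 < max (-u x) 0) = univ.filter (fun x => f x < c) := by
      refine filter_congr fun x _ => ?_
      rw [lt_max_iff, hu]
      simp only [lt_self_iff_false, or_false, neg_sub, sub_pos]
    rw [this]; exact hc2
  have h1 := sq_bottleneckRatioStar_mul_piInner_le hP hπ hπ0 (f := fun x => max (u x) 0)
    (fun x => le_max_right _ _) hpos
  have h2 := sq_bottleneckRatioStar_mul_piInner_le hP hπ hπ0 (f := fun x => max (-u x) 0)
    (fun x => le_max_right _ _) hneg
  have hsplitE := dirichletForm_posPart_add_negPart_le hπ0 hP.1 u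
  have hsplitI := piInner_posPart_add_negPart π u
  have hEu : dirichletForm π P u = dirichletForm π P f := dirichletForm_sub_const π P f c
  have hIu : piInner π u u = lawVariance π f + (lawMean π f - c) ^ 2 := piInner_sub_const_eq hπ1 f c
  have hΦ0 : 0 ≤ bottleneckRatioStar π P ^ 2 := sq_nonneg _
  have hVar : bottleneckRatioStar π P ^ 2 * lawVariance π f ≤
      bottleneckRatioStar π P ^ 2 * piInner π u u := by
    rw [hIu]; exact mul_le_mul_of_nonneg_left (by nlinarith [sq_nonneg (lawMean π f - c)]) hΦ0
  have hsum : bottleneckRatioStar π P ^ 2 * piInner π u u ≤ 2 * dirichletForm π P u := by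
    rw [← hsplitI, mul_add]
    linarith [h1, h2, hsplitE]
  rw [hEu] at hsum
  linarith [hVar, hsum]

omit [DecidableEq X] in
/-- `Gap_R ≥ 0` for `π ≥ 0`, `P ≥ 0`. [cite: AndrieuVihola2016, §3 (definition of `Gap_R` as an
infimum of the non-negative `𝓔`)] -/
theorem spectralGapR_nonneg {π : X → ℝ} (hπ0 : ∀ x, 0 ≤ π x) {P : Matrix X X ℝ}
    (hP0 : ∀ x y, 0 ≤ P x y) : 0 ≤ spectralGapR π P :=
  Real.sInf_nonneg (by rintro _ ⟨f, -, rfl⟩; exact dirichletForm_nonneg hπ0 hP0 f)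

/-- **Theorem 13.10 (Sinclair–Jerrum 1989, Lawler–Sokal 1988), LOWER BOUND: `Φ⋆²/2 ≤ Gap_R(P)`**
for a row-stochastic `P` with stationary probability vector `π ≥ 0` — every admissible `f`
(`f ⊥_π 1`, `‖f‖_π = 1`, so `Var_π(f) = 1`) has `𝓔(f) ≥ Φ⋆²/2` by
`LevinPeres2017_thm_13_10_lower_var`; when no set has `0 < π(S) ≤ ½` both sides are the junk
value `0` / `≥ 0`.  For a reversible `P`, `Gap_R = γ = 1 − λ₂` (Lemma 13.7) and this is the printed
`Φ⋆²/2 ≤ γ`. [cite: LevinPeres2017, §13.2.2 Thm 13.10 eq. (13.6), lower bound] -/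
theorem LevinPeres2017_thm_13_10_lower {P : X → X → ℝ} (hP : IsRowStochastic P) {π : X → ℝ}
    (hπ : IsStationary π P) (hπ0 : ∀ x, 0 ≤ π x) (hπ1 : ∑ x, π x = 1) :
    bottleneckRatioStar π P ^ 2 / 2 ≤ spectralGapR π P := by
  by_cases hX : ∃ S : Finset X, 0 < ∑ x ∈ S, π x ∧ ∑ x ∈ S, π x ≤ 1 / 2
  · -- the constraint set is nonempty (the normalised `f_S`), so `Gap_R` is a genuine infimum
    obtain ⟨S, hS0, hS⟩ := hX
    have hSc : 1 / 2 ≤ ∑ x ∈ Sᶜ, π x := by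
      have := sum_add_sum_compl S π
      rw [hπ1] at this
      linarith
    set V : ℝ := (∑ x ∈ S, π x) * ∑ x ∈ Sᶜ, π x with hV
    have hVpos : 0 < V := mul_pos hS0 (by linarith)
    set c : ℝ := 1 / Real.sqrt V with hc
    have hc2 : c ^ 2 = 1 / V := by rw [hc, div_pow, one_pow, Real.sq_sqrt hVpos.le]
    set g : X → ℝ := fun x => c * bottleneckTestFun π S x with hg
    have hg0 : ∑ x, π x * g x = 0 := by
      have : ∑ x, π x * (c * bottleneckTestFun π S x) =
          c * ∑ x, π x * bottleneckTestFun π S x := by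
        rw [mul_sum]; exact sum_congr rfl fun x _ => by ring
      simp only [hg]
      rw [this, sum_mul_bottleneckTestFun, mul_zero]
    have hg1 : piInner π g g = 1 := by
      have : piInner π g g = c ^ 2 * piInner π (bottleneckTestFun π S) (bottleneckTestFun π S) := by
        unfold piInner; rw [mul_sum]; exact sum_congr rfl fun x _ => by simp only [hg]; ring
      rw [this, piInner_bottleneckTestFun hπ1, ← hV, hc2, one_div, inv_mul_cancel₀ hVpos.ne']
    refine le_csInf ⟨_, ⟨g, ⟨hg0, hg1⟩, rfl⟩⟩ ?_
    rintro _ ⟨f, ⟨hf0, hf1⟩, rfl⟩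
    have hvar : lawVariance π f = 1 := by
      have hm : lawMean π f = 0 := hf0
      unfold lawVariance
      rw [hm]
      unfold piInner at hf1
      rw [← hf1]
      exact sum_congr rfl fun x _ => by ring
    have h := LevinPeres2017_thm_13_10_lower_var hP hπ hπ0 hπ1 f
    rw [hvar, mul_one] at h
    exact h
  · -- no set with `0 < π(S) ≤ ½`: `Φ⋆ = 0`
    have hΦ : bottleneckRatioStar π P = 0 := by
      unfold bottleneckRatioStar
      have : {S : Finset X | 0 < ∑ x ∈ S, π x ∧ ∑ x ∈ S, π x ≤ 1 / 2} = ∅ :=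
        Set.eq_empty_of_forall_notMem fun S hS => hX ⟨S, hS⟩
      rw [this, Set.image_empty, Real.sInf_empty]
    rw [hΦ]
    norm_num
    exact spectralGapR_nonneg hπ0 hP.1

/-- **Theorem 13.10 for the variational gap, both bounds: `Φ⋆²/2 ≤ Gap_R(P) ≤ 2Φ⋆`** (row-stochastic
`P`, stationary probability vector `π ≥ 0`, some set with `0 < π(S) ≤ ½`); the upper bound is
`BottleneckRatioSpectralGap.LevinPeres2017_thm_13_10_upper`.  `Gap_R = γ = 1 − λ₂` for reversible
`P` (Lemma 13.7). [cite: LevinPeres2017, §13.2.2 Thm 13.10 eq. (13.6)] -/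
theorem LevinPeres2017_thm_13_10_gapR {P : X → X → ℝ} (hP : IsRowStochastic P) {π : X → ℝ}
    (hπ : IsStationary π P) (hπ0 : ∀ x, 0 ≤ π x) (hπ1 : ∑ x, π x = 1)
    (hX : ∃ S : Finset X, 0 < ∑ x ∈ S, π x ∧ ∑ x ∈ S, π x ≤ 1 / 2) :
    bottleneckRatioStar π P ^ 2 / 2 ≤ spectralGapR π P ∧
      spectralGapR π P ≤ 2 * bottleneckRatioStar π P :=
  ⟨LevinPeres2017_thm_13_10_lower hP hπ hπ0 hπ1, LevinPeres2017_thm_13_10_upper hP hπ hπ0 hπ1 hX⟩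

end Literature.Probability.MarkovChains
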